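import Mathlib
import Summits.Ventures.HodgeRepro.Tier4.Common.MixedPlaneKType

/-!
# Tier4/Line4/AtInfinitePlace — elements of `G(𝔸_k)` supported at ONE infinite place (a `k`-matrix placed at `w₀`)

Blind re-derivation cell `pub-hodge-repro`, Tier 4 «prove the step» (README §9–§10), seat t4-L4-p2 (prover, LINE L4,
gen 3; bus S13737 / S13765).  Tree path `lean/Summits/Ventures/HodgeRepro/Tier4/Line4/AtInfinitePlace.lean`.
Mathlib-level (the product / restricted-product structure of the adele ring); no literature.  The archimedean twin of
L1-p5's sign adeles (`Tier4/Line1/SignAdele.lean`).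

* `placeAt w₀ : k →ₙ+* 𝔸_k` — the non-unital ring homomorphism `x ↦ (x at w₀, 0 elsewhere)`;
* `atInf w₀ A := 1 + (A − 1).map (placeAt w₀)` — the adelic `4 × 4` matrix with component `A` at `w₀` and `1` at every
  other place; multiplicative (`atInf_mul`), unital (`atInf_one`), with its components computed
  (`compInf_atInf_self`, `compInf_atInf_ne`, `compFin_atInf`); `ad_ext` / `mat_ext` = extensionality of adeles and
  adelic matrices through their components;
* `gaAtInf W w₀ A A' …` — the element of `G(𝔸_k) = U(W)(𝔸_k)` (typer-2's `unitaryGroup`) attached to `A ∈ U(W)(k)`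
  with inverse `A'`: it lies in `atPlace W w₀` (`gaAtInf_mem_atPlace`), in the commutant of every `k`-matrix commuting
  with `A` (`gaAtInf_mem_commutant`), and its entries at `w₀` (`entryAt_gaAtInf`, `entryAtConj_gaAtInf`) are the entries
  of `A` — the inputs of `localTorusAt`, `localTorusAt'`, `weightAt`, `weightAt'` (typer-2's `MixedPlaneKType`).

Nothing here says anything about the status of the Hodge conjecture for CM abelian varieties, which is NOT proved
(HC_CM is NOT proved by anyone in this repository).
-/

set_option autoImplicit false

noncomputable section

namespace Summit.Ventures.HodgeRepro.Tier4.Line4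

open Summit.Ventures.HodgeRepro.Tier4.Common NumberField Matrix

section Adelic

open IsDedekindDomain
open scoped Classical

variable {k : Type} [Field k] [NumberField k]

/-- **Placing a scalar at one infinite place**: the non-unital ring homomorphism `k → 𝔸_k`, `x ↦ (x at w₀, 0 elsewhere)`
(archimedean component `algebraMap k k_{w₀} x` at `w₀`, `0` at every other place). -/
def placeAt (w₀ : InfinitePlace k) : k →ₙ+* Ad k where
  toFun x := (Pi.single w₀ (algebraMap k w₀.Completion x), 0)
  map_mul' x y := by
    refine Prod.ext ?_ ?_
    · show Pi.single w₀ (algebraMap k w₀.Completion (x * y)) =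
        Pi.single w₀ (algebraMap k w₀.Completion x) * Pi.single w₀ (algebraMap k w₀.Completion y)
      rw [map_mul, Pi.single_mul]
    · show (0 : FiniteAdeleRing (𝓞 k) k) = 0 * 0
      rw [mul_zero]
  map_zero' := by
    refine Prod.ext ?_ rfl
    show Pi.single w₀ (algebraMap k w₀.Completion 0) = 0
    rw [map_zero, Pi.single_zero]
  map_add' x y := by
    refine Prod.ext ?_ ?_
    · show Pi.single w₀ (algebraMap k w₀.Completion (x + y)) =
        Pi.single w₀ (algebraMap k w₀.Completion x) + Pi.single w₀ (algebraMap k w₀.Completion y)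
      rw [map_add, Pi.single_add]
    · show (0 : FiniteAdeleRing (𝓞 k) k) = 0 + 0
      rw [add_zero]

/-- The component at `w₀` of `placeAt w₀ x` is `x`. -/
theorem adComponentInf_placeAt_self (w₀ : InfinitePlace k) (x : k) :
    adComponentInf k w₀ (placeAt w₀ x) = algebraMap k w₀.Completion x := by
  show Pi.single w₀ (algebraMap k w₀.Completion x) w₀ = _
  rw [Pi.single_eq_same]

/-- The component at `w ≠ w₀` of `placeAt w₀ x` is `0`. -/
theorem adComponentInf_placeAt_ne (w₀ w : InfinitePlace k) (h : w ≠ w₀) (x : k) :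
    adComponentInf k w (placeAt w₀ x) = 0 := by
  show Pi.single w₀ (algebraMap k w₀.Completion x) w = _
  rw [Pi.single_eq_of_ne h]

/-- The finite components of `placeAt w₀ x` are `0`. -/
theorem adComponentFin_placeAt (w₀ : InfinitePlace k) (v : HeightOneSpectrum (𝓞 k)) (x : k) :
    adComponentFin k v (placeAt w₀ x) = 0 := by
  show RestrictedProduct.evalRingHom (fun v : HeightOneSpectrum (𝓞 k) => v.adicCompletion k) v
    (0 : FiniteAdeleRing (𝓞 k) k) = 0
  exact map_zero _

/-- **Extensionality of adeles through their components.** -/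
theorem ad_ext {x y : Ad k} (hinf : ∀ w : InfinitePlace k, adComponentInf k w x = adComponentInf k w y)
    (hfin : ∀ v : HeightOneSpectrum (𝓞 k), adComponentFin k v x = adComponentFin k v y) :
    x = y := by
  refine Prod.ext (funext fun w => hinf w) ?_
  apply FiniteAdeleRing.ext
  intro v
  exact hfin v

/-- **A `k`-matrix placed at `w₀`**: `1 + placeAt w₀ (A − 1)` entrywise — component `A` at `w₀`, `1` elsewhere. -/
def atInf (w₀ : InfinitePlace k) (A : Matrix (Fin 4) (Fin 4) k) : M4 k :=
  1 + (A - 1).map (placeAt w₀)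

/-- `atInf` is multiplicative. -/
theorem atInf_mul (w₀ : InfinitePlace k) (A B : Matrix (Fin 4) (Fin 4) k) :
    atInf w₀ (A * B) = atInf w₀ A * atInf w₀ B := by
  unfold atInf
  have h : A * B - 1 = (A - 1) + (B - 1) + (A - 1) * (B - 1) := by noncomm_ring
  rw [h, Matrix.map_add _ (map_add _), Matrix.map_add _ (map_add _), Matrix.map_mul]
  noncomm_ring

/-- `atInf 1 = 1`. -/
theorem atInf_one (w₀ : InfinitePlace k) : atInf w₀ (1 : Matrix (Fin 4) (Fin 4) k) = 1 := by
  unfold atInf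
  rw [sub_self, Matrix.map_zero _ (map_zero _), add_zero]

/-- The transpose of `atInf A` is `atInf Aᵀ`. -/
theorem atInf_transpose (w₀ : InfinitePlace k) (A : Matrix (Fin 4) (Fin 4) k) :
    (atInf w₀ A)ᵀ = atInf w₀ Aᵀ := by
  unfold atInf
  rw [Matrix.transpose_add, Matrix.transpose_one, ← Matrix.transpose_map, Matrix.transpose_sub,
    Matrix.transpose_one]

/-- Extensionality of adelic matrices through their components. -/
theorem mat_ext {M N : M4 k}
    (hinf : ∀ w : InfinitePlace k, (adComponentInf k w).mapMatrix M = (adComponentInf k w).mapMatrix N)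
    (hfin : ∀ v : HeightOneSpectrum (𝓞 k),
      (adComponentFin k v).mapMatrix M = (adComponentFin k v).mapMatrix N) : M = N := by
  ext i j
  refine ad_ext (fun w => ?_) (fun v => ?_)
  · have := congrFun (congrFun (hinf w) i) j
    simpa [RingHom.mapMatrix_apply] using this
  · have := congrFun (congrFun (hfin v) i) j
    simpa [RingHom.mapMatrix_apply] using this

/-- `placeAt` followed by the component at `w₀` is the structure map. -/
theorem adComponentInf_comp_placeAt_self (w₀ : InfinitePlace k) :
    (adComponentInf k w₀ : Ad k → w₀.Completion) ∘ placeAt w₀ = algebraMap k w₀.Completion :=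
  funext fun x => adComponentInf_placeAt_self w₀ x

/-- `placeAt` followed by the component at `w ≠ w₀` is `0`. -/
theorem adComponentInf_comp_placeAt_ne (w₀ w : InfinitePlace k) (h : w ≠ w₀) :
    (adComponentInf k w : Ad k → w.Completion) ∘ placeAt w₀ = fun _ => 0 :=
  funext fun x => adComponentInf_placeAt_ne w₀ w h x

/-- `placeAt` followed by a finite component is `0`. -/
theorem adComponentFin_comp_placeAt (w₀ : InfinitePlace k) (v : HeightOneSpectrum (𝓞 k)) :
    (adComponentFin k v : Ad k → v.adicCompletion k) ∘ placeAt w₀ = fun _ => 0 :=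
  funext fun x => adComponentFin_placeAt w₀ v x

/-- The component of `atInf A` at `w₀` is `A`. -/
theorem compInf_atInf_self (w₀ : InfinitePlace k) (A : Matrix (Fin 4) (Fin 4) k) :
    (adComponentInf k w₀).mapMatrix (atInf w₀ A) = A.map (algebraMap k w₀.Completion) := by
  rw [RingHom.mapMatrix_apply, atInf, Matrix.map_add _ (map_add _), Matrix.map_one _ (map_zero _) (map_one _),
    Matrix.map_map, adComponentInf_comp_placeAt_self,
    Matrix.map_sub _ (map_sub _), Matrix.map_one _ (map_zero _) (map_one _), add_sub_cancel]

/-- The component of `atInf A` at `w ≠ w₀` is `1`. -/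
theorem compInf_atInf_ne (w₀ w : InfinitePlace k) (h : w ≠ w₀) (A : Matrix (Fin 4) (Fin 4) k) :
    (adComponentInf k w).mapMatrix (atInf w₀ A) = 1 := by
  rw [RingHom.mapMatrix_apply, atInf, Matrix.map_add _ (map_add _), Matrix.map_one _ (map_zero _) (map_one _),
    Matrix.map_map, adComponentInf_comp_placeAt_ne w₀ w h]
  have : (A - 1).map (fun _ : k => (0 : w.Completion)) = 0 := by
    ext i j
    rfl
  rw [this, add_zero]

/-- The finite components of `atInf A` are `1`. -/
theorem compFin_atInf (w₀ : InfinitePlace k) (v : HeightOneSpectrum (𝓞 k))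
    (A : Matrix (Fin 4) (Fin 4) k) : (adComponentFin k v).mapMatrix (atInf w₀ A) = 1 := by
  rw [RingHom.mapMatrix_apply, atInf, Matrix.map_add _ (map_add _), Matrix.map_one _ (map_zero _) (map_one _),
    Matrix.map_map, adComponentFin_comp_placeAt w₀ v]
  have : (A - 1).map (fun _ : k => (0 : v.adicCompletion k)) = 0 := by
    ext i j
    rfl
  rw [this, add_zero]

/-- The infinite component of a principal matrix. -/
theorem compInf_adMat (w : InfinitePlace k) (C : Matrix (Fin 4) (Fin 4) k) :
    (adComponentInf k w).mapMatrix (adMat k C) = C.map (algebraMap k w.Completion) := by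
  ext i j
  rfl

/-- The finite component of a principal matrix. -/
theorem compFin_adMat (v : HeightOneSpectrum (𝓞 k)) (C : Matrix (Fin 4) (Fin 4) k) :
    (adComponentFin k v).mapMatrix (adMat k C) = C.map (algebraMap k (v.adicCompletion k)) := by
  ext i j
  rfl

/-- `atInf A` commutes with the principal matrix of every `C` commuting with `A`. -/
theorem atInf_mul_adMat_comm (w₀ : InfinitePlace k) {A C : Matrix (Fin 4) (Fin 4) k} (h : A * C = C * A) :
    atInf w₀ A * adMat k C = adMat k C * atInf w₀ A := by
  refine mat_ext (fun w => ?_) (fun v => ?_)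
  · rw [map_mul, map_mul, compInf_adMat]
    by_cases hw : w = w₀
    · subst hw
      rw [compInf_atInf_self, ← Matrix.map_mul, ← Matrix.map_mul, h]
    · rw [compInf_atInf_ne w₀ w hw, Matrix.one_mul, Matrix.mul_one]
  · rw [map_mul, map_mul, compFin_atInf, Matrix.one_mul, Matrix.mul_one]

/-- `atInf A` is an isometry of the principal form of `C` when `A` is. -/
theorem atInf_isometry (w₀ : InfinitePlace k) {A C : Matrix (Fin 4) (Fin 4) k} (h : A * C * Aᵀ = C) :
    atInf w₀ A * adMat k C * (atInf w₀ A)ᵀ = adMat k C := by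
  rw [atInf_transpose]
  refine mat_ext (fun w => ?_) (fun v => ?_)
  · rw [map_mul, map_mul, compInf_adMat]
    by_cases hw : w = w₀
    · subst hw
      rw [compInf_atInf_self, compInf_atInf_self, ← Matrix.map_mul, ← Matrix.map_mul, h]
    · rw [compInf_atInf_ne w₀ w hw, compInf_atInf_ne w₀ w hw, Matrix.one_mul, Matrix.mul_one]
  · rw [map_mul, map_mul, compFin_atInf, compFin_atInf, Matrix.one_mul, Matrix.mul_one]

variable (W : PlaneData k)

/-- **The element of `G(𝔸_k)` supported at `w₀`** attached to `A ∈ U(W)(k)` (inverse `A'`). -/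
def gaAtInf (w₀ : InfinitePlace k) (A A' : Matrix (Fin 4) (Fin 4) k) (hAA' : A * A' = 1) (hA'A : A' * A = 1)
    (hΩ : A * W.Ω = W.Ω * A) (hB : A * W.B * Aᵀ = W.B) : GA W :=
  ⟨⟨atInf w₀ A, atInf w₀ A', by rw [← atInf_mul, hAA', atInf_one], by rw [← atInf_mul, hA'A, atInf_one]⟩,
    atInf_mul_adMat_comm w₀ hΩ, atInf_isometry w₀ hB⟩

/-- The adelic matrix of `gaAtInf`. -/
theorem gaAtInf_mat (w₀ : InfinitePlace k) (A A' : Matrix (Fin 4) (Fin 4) k) (hAA' : A * A' = 1)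
    (hA'A : A' * A = 1) (hΩ : A * W.Ω = W.Ω * A) (hB : A * W.B * Aᵀ = W.B) :
    GA.mat W (gaAtInf W w₀ A A' hAA' hA'A hΩ hB) = atInf w₀ A := rfl

/-- Two elements of `G(𝔸_k)` with the same matrix are equal. -/
theorem GA.ext_mat {g h : GA W} (e : GA.mat W g = GA.mat W h) : g = h :=
  Subtype.ext (Units.ext e)

/-- `gaAtInf` lies in the commutant of every `k`-matrix commuting with `A`. -/
theorem gaAtInf_mem_commutant (w₀ : InfinitePlace k) (A A' : Matrix (Fin 4) (Fin 4) k) (hAA' : A * A' = 1)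
    (hA'A : A' * A = 1) (hΩ : A * W.Ω = W.Ω * A) (hB : A * W.B * Aᵀ = W.B) {C : Matrix (Fin 4) (Fin 4) k}
    (h : A * C = C * A) : gaAtInf W w₀ A A' hAA' hA'A hΩ hB ∈ commutant W C :=
  atInf_mul_adMat_comm w₀ h

/-- The finite components of `gaAtInf` are trivial. -/
theorem gaAtInf_finiteComponent (w₀ : InfinitePlace k) (A A' : Matrix (Fin 4) (Fin 4) k) (hAA' : A * A' = 1)
    (hA'A : A' * A = 1) (hΩ : A * W.Ω = W.Ω * A) (hB : A * W.B * Aᵀ = W.B)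
    (v : HeightOneSpectrum (𝓞 k)) :
    GA.finiteComponent W v (gaAtInf W w₀ A A' hAA' hA'A hΩ hB) = 1 := by
  apply Units.ext
  show (adComponentFin k v).mapMatrix (atInf w₀ A) = 1
  exact compFin_atInf w₀ v A

/-- The infinite components of `gaAtInf` away from `w₀` are trivial. -/
theorem gaAtInf_infiniteComponent_ne (w₀ : InfinitePlace k) (A A' : Matrix (Fin 4) (Fin 4) k)
    (hAA' : A * A' = 1) (hA'A : A' * A = 1) (hΩ : A * W.Ω = W.Ω * A) (hB : A * W.B * Aᵀ = W.B)
    (w : InfinitePlace k) (hw : w ≠ w₀) :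
    GA.infiniteComponent W w (gaAtInf W w₀ A A' hAA' hA'A hΩ hB) = 1 := by
  apply Units.ext
  show (adComponentInf k w).mapMatrix (atInf w₀ A) = 1
  exact compInf_atInf_ne w₀ w hw A

/-- `gaAtInf` is supported at `w₀`. -/
theorem gaAtInf_mem_atPlace (w₀ : InfinitePlace k) (A A' : Matrix (Fin 4) (Fin 4) k) (hAA' : A * A' = 1)
    (hA'A : A' * A = 1) (hΩ : A * W.Ω = W.Ω * A) (hB : A * W.B * Aᵀ = W.B) :
    gaAtInf W w₀ A A' hAA' hA'A hΩ hB ∈ atPlace W w₀ :=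
  ⟨fun v => gaAtInf_finiteComponent W w₀ A A' hAA' hA'A hΩ hB v,
    fun w hw => gaAtInf_infiniteComponent_ne W w₀ A A' hAA' hA'A hΩ hB w hw⟩

/-- The `w₀`-component of `gaAtInf` is `A` (as a matrix over `k_{w₀}`). -/
theorem gaAtInf_infiniteComponent_self (w₀ : InfinitePlace k) (A A' : Matrix (Fin 4) (Fin 4) k)
    (hAA' : A * A' = 1) (hA'A : A' * A = 1) (hΩ : A * W.Ω = W.Ω * A) (hB : A * W.B * Aᵀ = W.B) :
    ((GA.infiniteComponent W w₀ (gaAtInf W w₀ A A' hAA' hA'A hΩ hB) : GL (Fin 4) w₀.Completion) :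
      Matrix (Fin 4) (Fin 4) w₀.Completion) = A.map (algebraMap k w₀.Completion) := by
  show (adComponentInf k w₀).mapMatrix (atInf w₀ A) = _
  exact compInf_atInf_self w₀ A

/-- The entries of `gaAtInf` at `w₀`. -/
theorem entryAt_gaAtInf (w₀ : InfinitePlace k) (A A' : Matrix (Fin 4) (Fin 4) k) (hAA' : A * A' = 1)
    (hA'A : A' * A = 1) (hΩ : A * W.Ω = W.Ω * A) (hB : A * W.B * Aᵀ = W.B) (i j : Fin 4) :
    entryAt W w₀ (gaAtInf W w₀ A A' hAA' hA'A hΩ hB) i j =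
      InfinitePlace.Completion.extensionEmbedding w₀ (algebraMap k w₀.Completion (A i j)) := by
  unfold entryAt
  rw [gaAtInf_infiniteComponent_self]
  rfl

/-- The conjugated entries of `gaAtInf` at `w₀`. -/
theorem entryAtConj_gaAtInf (w₀ : InfinitePlace k) (g g' : Matrix (Fin 4) (Fin 4) k)
    (A A' : Matrix (Fin 4) (Fin 4) k) (hAA' : A * A' = 1) (hA'A : A' * A = 1) (hΩ : A * W.Ω = W.Ω * A)
    (hB : A * W.B * Aᵀ = W.B) (i j : Fin 4) :
    entryAtConj W w₀ g g' (gaAtInf W w₀ A A' hAA' hA'A hΩ hB) i j =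
      InfinitePlace.Completion.extensionEmbedding w₀ (algebraMap k w₀.Completion ((g' * A * g) i j)) := by
  unfold entryAtConj
  rw [gaAtInf_infiniteComponent_self, ← Matrix.map_mul, ← Matrix.map_mul]
  rfl

end Adelic

end Summit.Ventures.HodgeRepro.Tier4.Line4

end
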